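import Summits.BirchSwinnertonDyer.BirchSwinnertonDyer.Theses.KatoDescentTamePotSupersingular
import Summits.BirchSwinnertonDyer.Rank1Residual.X4.KuriharaLowerHalf
import Summits.BirchSwinnertonDyer.Rank1Residual.Additive.N11KimAtThreePUB
import Summits.BirchSwinnertonDyer.Rank1Residual.O5.NoLocalThreeTorsionIIIstar
import Summits.BirchSwinnertonDyer.Rank1Residual.Supersingular.DescentLowerBound
import HarnessLib

/-!
# Route `KatoDescentTamePotSupersingular` (rung K8, sub-rung B4 (t′), cell `bsd-potss`): the crux
# `TameLowerHalfRankZero` (L₀, item stmt-BirchSwinnertonDyer-19981) — the PER-PAIR CERTIFICATE ROADS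
# on the tame potentially-supersingular rows (a `--supports` file; companion of
# `KatoDescentTamePotSupersingularTameLowerHalf{OfKMC,FwLocus,CMRows}.lean`)

The companions record the CLASS-WIDE conditional roads to L₀ = `ord_p #Ш_an ≤ ord_p #Ш` on the (t′)
rows (`Addv W p ∧ SubTprime W p`): Kato's Main Conjecture (interface KMC, D-O6-2, open; on the
tower-surjective rows L₀ is EQUIVALENT to its trivial component), the Fouquet–Wan claim (PRE) on
`X4 ∧ LocIrr ∧ FWNonsplitRam`, the CM rows (in print). This file records what the tree does PER PAIR
from PUBLISHED theorems, restricted to the route's binders, and the reshaped composition it yields: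

* §1 (`p ≥ 5`, `ρ̄_{E,p}` onto): C.-H. Kim, Amer. J. Math. 148 (2026) Thm. 1.8 (6) read at level
  `p^k` — tree fact `Kim2026.rankZero_le_padicValNat_sha_of_kuriharaNumber_ne_zero`, NO hypothesis
  on the reduction at `p` (the additive case is inside Kim's proof, Prop. 3.2 / Lemma 3.10; Kim's
  Manin hypothesis is the datum `D` with `p ∤ c_D`): ONE Kurihara number `δ̃_n^{(k)} ≠ 0` of level
  `k ≤ ord_p ∏ c_ℓ + 1` gives L₀ at the pair (`tameMissingLowerBoundAt_rankZero_of_kimLower`); a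
  UNIT `δ̃_n` with `p ∤ ∏ c_ℓ` gives `BSD(E,p)` (`tameBsdp_rankZero_of_kuriharaUnitAt`). No `LocIrr`,
  no Steinberg prime, no main conjecture: on `(t′) ∧ surj(p) ∧ r_an = 0`, `p ≥ 5`, the lower half is
  a PUBLISHED theorem plus a finite modular-symbol certificate per pair; class-wide the existence of
  the certificates is Kurihara's conjecture (Kato's IMC with `μ = 0`, Kim Thm. 1.10 / Conj. 1.3),
  displayed as `hKur` in `tameLowerHalf_largeImage_of_kimLower_of_kuriharaCerts`.
* §2 (`p = 3`, `e = 4`: the BC5 rung `stub_lower_three_e4_rung`, Kodaira `III`/`III*`, tower onto):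
  rung W2's leaf `N11.KimAtThreeRankZeroPUB` (a refereed CELL theorem of `bsd-addord`, an
  `@[conjecture]` node, NOT a Literature fact; no reduction hypothesis at `3`) needs `E(ℚ₃)[3] = 0`
  — and on the `III*` half (`v₃(Δ) = 9`) THAT BINDER IS A THEOREM of the tree
  (`O5.forall_three_nsmul_eq_zero_of_kodairaSymbolAt_IIIstar`, Tate's Step 9), here put in Kim's
  counting currency. So the rung statement `Sig.stub_lower_three_e4_rung` follows VERBATIM from the
  leaf + certificates on its `t = 0` rows + the residual type-`III` rows with `E(ℚ₃)[3] ≠ 0`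
  displayed (`tameLowerHalf_three_e4_rung_of_kimAtThree_of_certs_of_typeIIIRows`).
* §3 (any odd `p`, any image — the road left for X3 ∩ (t′)): the native `p`-descent certificate
  `Sel^{(p)}(E/ℚ) ≠ 0` upgraded by Cassels–Tate squareness on the `ord_p #Ш_an ≤ 2` rows.
* §4 the crux BY NAME from §1/§2's class hypotheses and the RESIDUAL rows displayed (`p ≥ 5` with
  `ρ̄` not onto — X3 ∩ (t′), normaliser-of-Cartan images, CM —; `p = 3` off the tower or type `III`
  with `E(ℚ₃)[3] ≠ 0`): `tameLowerHalfRankZero_of_kuriharaCerts_of_residualRows`.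

Honest status: nothing here lowers the CLASS-WIDE difficulty of the item (Kurihara's conjecture on a
class is Kato's IMC there); it separates the rows where L₀ is "published theorem + per-pair
certificate" from the rows with no mechanism in print, and ties the former to the census instruments
(Kurihara numbers) and to rung W2. Every conjectural input is displayed; GZK, modularity,
Cassels–Tate are published inputs by name. Conditional; the item is NOT closed. Seat
`bsd-potss-k8t-c2` (prover), generation 2.

References: [Kim2022StructureSelmer] Thm. 1.9 (1),(6), Thm. 1.11, Conj. 1.3, §1.3.5, §1.5.1 (arXiv
v4; = Thm. 1.8/1.10 of Amer. J. Math. 148 (2026)); [Kim2025RefinedTNC] Thm. 1.1/1.2;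
[Kurihara2014] §1; [SilvermanATAEC1994] IV.9.4 Step 9; [Miller2011LMS] Def. 1.1; [Darmon2004]
Thm. 3.22 (GZK); [Cassels1962ArithmeticIV] Thm. 1.1 (Cassels–Tate).
-/

set_option autoImplicit false
-- sibling precedent (`…TameLowerHalfFwLocus.lean`): the directory name repeats the summit name
set_option linter.dupNamespace false

noncomputable section

open scoped Classical MatrixGroups ModularForm

namespace Summit.BirchSwinnertonDyer.BirchSwinnertonDyer.Theorems

open CongruenceSubgroup WeierstrassCurve Literature.NumberTheory.EllipticCurves
  Literature.NumberTheory.EllipticCurves.ModularForms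
  Literature.NumberTheory.EllipticCurves.Rank1Residual
  Literature.NumberTheory.EllipticCurves.Rank1Residual.Typed
  Summit.BirchSwinnertonDyer.Rank1Residual
  Summit.BirchSwinnertonDyer.Rank1Residual.Additive
  Summit.BirchSwinnertonDyer.BirchSwinnertonDyer.Theses.KatoDescentTamePotSupersingular

/-! ## §1 `p ≥ 5`, `ρ̄_{E,p}` onto: Kim's level-`k` Kurihara certificate (PUBLISHED, any reduction at `p`) -/

section LargeImage

/-- **L₀ at a (t′) rank-`0` pair, `p ≥ 5`, `ρ̄_{E,p}` onto, from ONE level-`k` Kurihara number with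
`k ≤ ord_p ∏ c_ℓ + 1`** (Kim, Amer. J. Math. 148 (2026) Thm. 1.8 (6) beyond the unit case, tree fact
`hKim` — NO reduction hypothesis at `p`; GZK; modularity; a datum `D` with `p ∤ c_D` = Kim's Manin
hypothesis, needed exactly at an additive `p`; period transfer; a level `n ∈ 𝒩_k` with cyclic
reductions; `kuriharaNumber D.f (p^k) n ψ ≠ 0`): the cell's `X4.missingLowerBoundAt_rankZero_of_kimLower`
on the route's rows. Per pair; NOT a class theorem.
[cite: Kim2022StructureSelmer, Thm. 1.9 (6) (PDF p. 8), §1.5.1 (PDF p. 7), §1.3.5 (PDF p. 6)]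
[cite: Miller2011LMS, Def. 1.1] -/
theorem tameMissingLowerBoundAt_rankZero_of_kimLower
    (hKim : Kim2026.rankZero_le_padicValNat_sha_of_kuriharaNumber_ne_zero)
    (hGZK : rank_eq_analyticRank_of_analyticRank_le_one) (hmod : hasEntireLFunction_rat)
    (W : WeierstrassCurve ℚ) [W.IsElliptic] [W.IsGloballyMinimal] (p : ℕ) [Fact p.Prime]
    (hr : W.analyticRank = 0) (hp5 : 5 ≤ p) (_hadd : Addv W p) (_hT : SubTprime W p)
    (hsurj : Surj W p)
    {N : ℕ} [NeZero N] (D : ModularParametrizationData W N) (hc : ¬ (p : ℤ) ∣ D.maninConstant)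
    (hper : ∃ u : ℚ, ‖(u : ℚ_[p])‖ = 1 ∧ W.realPeriodRat = u * plusPeriod D.f)
    (k n : ℕ) [NeZero n] (hk : 1 ≤ k) (hkt : k ≤ padicValNat p W.tamagawaProduct + 1)
    (hn : Kato.IsKolyvaginProduct W p k n)
    (hcyc : ∀ (ℓ : ℕ) [Fact ℓ.Prime], ℓ ∣ n →
      Nat.card {P : ((WeierstrassCurve.integralModelInt W).map
          (Int.castRingHom (ZMod ℓ))).toAffine.Point // p • P = 0} ≤ p)
    (ψ : (ℓ : ℕ) → (ZMod ℓ)ˣ →* Multiplicative (ZMod (p ^ k)))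
    (hψ : ∀ ℓ ∈ n.primeFactors, Function.Surjective (ψ ℓ))
    (hδ : kuriharaNumber D.f (p ^ k) n ψ ≠ 0) : MissingLowerBoundAt W p :=
  X4.missingLowerBoundAt_rankZero_of_kimLower W p hKim hGZK hp5 hsurj
    ((W.analyticRank_eq_zero_iff_holds (hmod W)).mp hr) D hc hper k n hk hkt hn hcyc ψ hψ hδ

/-- **`BSD(E,p)` at a (t′) rank-`0` pair, `p ≥ 5`, `ρ̄_{E,p}` onto, `p ∤ ∏ c_ℓ`, from ONE UNIT
Kurihara number** (`X4.KuriharaUnitAt W p D.f`; Kim 2026 Thm. 1.8 (1),(6) at any reduction type, tree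
fact `hKim`; GZK, modularity, Manin datum, period transfer): the cell's
`X4.bsdp_of_kuriharaUnitAt_of_analyticRank_eq_zero` on the (t′) rows (`ρ̄` onto ⇒ `E[p]` irreducible).
Per pair. [cite: Kim2022StructureSelmer, Thm. 1.9 (1) and (6) (PDF pp. 7–8), Thm. 1.11 (PDF p. 8), §1.3.5]
[cite: Miller2011LMS, Def. 1.1] -/
theorem tameBsdp_rankZero_of_kuriharaUnitAt
    (hKim : Kim2022_rankZero_padicValRat_sha_of_kuriharaNumber_ne_zero_of_maninConstant)
    (hGZK : rank_eq_analyticRank_of_analyticRank_le_one) (hmod : hasEntireLFunction_rat)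
    (W : WeierstrassCurve ℚ) [W.IsElliptic] [W.IsGloballyMinimal] (p : ℕ) [Fact p.Prime]
    (hr : W.analyticRank = 0) (hp5 : 5 ≤ p) (hadd : Addv W p) (_hT : SubTprime W p)
    (hsurj : Surj W p)
    {N : ℕ} [NeZero N] (D : ModularParametrizationData W N) (hc : ¬ (p : ℤ) ∣ D.maninConstant)
    (hper : ∃ u : ℚ, ‖(u : ℚ_[p])‖ = 1 ∧ W.realPeriodRat = u * plusPeriod D.f)
    (htam : ¬ p ∣ W.tamagawaProduct) (hK : X4.KuriharaUnitAt W p D.f) : BSDp W p :=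
  X4.bsdp_of_kuriharaUnitAt_of_analyticRank_eq_zero W p hKim hGZK hmod hp5
    ⟨by omega, hadd, hasIrreducibleModPGaloisRep_of_hasSurjectiveModNGaloisRep W p hsurj⟩ hsurj hr D
    hc hper htam hK

/-- **The LARGE-IMAGE (t′) rank-`0` rows at `p ≥ 5` from Kim's published theorem and KURIHARA'S
CONJECTURE on those rows** — displayed as `hKur`: every such curve carries a datum with `p ∤ c_D`,
the period transfer, and a Kurihara number of some level `k ≤ ord_p ∏ c_ℓ + 1` non-zero modulo `p^k`
(per pair a finite certificate; class-wide Kato's IMC with `μ = 0`, Kim Thm. 1.10 / Conj. 1.3). These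
rows contain the surjective part of the Fouquet–Wan locus and more (no `LocIrr`, no Steinberg prime);
the rows with `ρ̄` NOT onto are outside. Conditional; nothing credited.
[cite: Kim2022StructureSelmer, Thm. 1.9 (6), Thm. 1.11, Conj. 1.3 (PDF pp. 7–8)]
[cite: Kurihara2014, §1] [cite: Miller2011LMS, Def. 1.1] -/
theorem tameLowerHalf_largeImage_of_kimLower_of_kuriharaCerts
    (hKim : Kim2026.rankZero_le_padicValNat_sha_of_kuriharaNumber_ne_zero)
    (hGZK : rank_eq_analyticRank_of_analyticRank_le_one) (hmod : hasEntireLFunction_rat)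
    (hKur : ∀ (W : WeierstrassCurve ℚ) [W.IsElliptic] [W.IsGloballyMinimal] (p : ℕ) [Fact p.Prime],
      W.analyticRank = 0 → 5 ≤ p → Addv W p → SubTprime W p → Surj W p →
        ∃ (N : ℕ) (_ : NeZero N) (D : ModularParametrizationData W N),
          ¬ (p : ℤ) ∣ D.maninConstant ∧
          (∃ u : ℚ, ‖(u : ℚ_[p])‖ = 1 ∧ W.realPeriodRat = u * plusPeriod D.f) ∧
          ∃ (k n : ℕ) (_ : NeZero n), 1 ≤ k ∧ k ≤ padicValNat p W.tamagawaProduct + 1 ∧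
            Kato.IsKolyvaginProduct W p k n ∧
            (∀ (ℓ : ℕ) [Fact ℓ.Prime], ℓ ∣ n →
              Nat.card {P : ((WeierstrassCurve.integralModelInt W).map
                  (Int.castRingHom (ZMod ℓ))).toAffine.Point // p • P = 0} ≤ p) ∧
            ∃ ψ : (ℓ : ℕ) → (ZMod ℓ)ˣ →* Multiplicative (ZMod (p ^ k)),
              (∀ ℓ ∈ n.primeFactors, Function.Surjective (ψ ℓ)) ∧
                kuriharaNumber D.f (p ^ k) n ψ ≠ 0) :
    ∀ (W : WeierstrassCurve ℚ) [W.IsElliptic] [W.IsGloballyMinimal] (p : ℕ) [Fact p.Prime],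
      W.analyticRank = 0 → 5 ≤ p → Addv W p → SubTprime W p → Surj W p →
        MissingLowerBoundAt W p := by
  intro W _ _ p _ hr hp5 hadd hT hsurj
  obtain ⟨N, hN, D, hc, hper, k, n, hn0, hk, hkt, hn, hcyc, ψ, hψ, hδ⟩ :=
    hKur W p hr hp5 hadd hT hsurj
  haveI := hN
  haveI := hn0
  exact tameMissingLowerBoundAt_rankZero_of_kimLower hKim hGZK hmod W p hr hp5 hadd hT hsurj D hc
    hper k n hk hkt hn hcyc ψ hψ hδ

end LargeImage

/-! ## §2 `p = 3`, `e = 4` (the BC5 rung): rung W2's leaf + certificates; `t = 0` is a theorem on `III*` -/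

section Three

/-- **`W(ℚ₃)[3] = 0` in Kim's counting currency**: if every `ℚ₃`-point killed by `3` is `O`, the
`3`-torsion subtype is the singleton `{O}` (the binder `ht0` of `N11.KimAtThreeRankZeroPUB`). [folklore] -/
theorem natCard_threeTorsion_eq_one_of_forall_nsmul_eq_zero (W : WeierstrassCurve ℚ)
    (h : ∀ P : (W.baseChange ℚ_[3]).toAffine.Point, (3 : ℕ) • P = 0 → P = 0) :
    Nat.card {Q : (W.baseChange ℚ_[3]).toAffine.Point // (3 : ℕ) • Q = 0} = 1 := by
  rw [Nat.card_eq_one_iff_unique]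
  exact ⟨⟨fun a b => Subtype.ext ((h a.1 a.2).trans (h b.1 b.2).symm)⟩, ⟨⟨0, nsmul_zero _⟩⟩⟩

/-- **On the `III*` half of the rung, `#W(ℚ₃)[3] = 1` is a THEOREM**: for globally minimal `W`,
additive at `3`, in (t′) (`SubTprime W 3` ⟺ Kodaira `III` or `III*`), `v₃(Δ) = 9` singles out
`III*`, where Tate's Step-9 normal form forbids a `ℚ₃`-rational `3`-torsion point (tree
`O5.forall_three_nsmul_eq_zero_of_kodairaSymbolAt_IIIstar`). Discharges Kim's `t = 0` binder there.
[cite: SilvermanATAEC1994, IV.9.4 Step 9 and Table 4.1 (PDF pp. 346, 365)] -/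
theorem natCard_threeTorsion_eq_one_of_subTprime_of_padicValRat_Δ_eq_nine
    (W : WeierstrassCurve ℚ) [W.IsElliptic] [W.IsGloballyMinimal]
    (hadd : Addv W 3) (hT : SubTprime W 3) (h9 : padicValRat 3 W.Δ = 9) :
    Nat.card {Q : (W.baseChange ℚ_[3]).toAffine.Point // (3 : ℕ) • Q = 0} = 1 :=
  natCard_threeTorsion_eq_one_of_forall_nsmul_eq_zero W
    (O5.forall_three_nsmul_eq_zero_of_kodairaSymbolAt_IIIstar W
      (O5.kodairaSymbolAt_eq_IIIstar_of_subTprime_of_padicValRat_Δ_eq_nine W hadd hT h9))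

/-- **L₀ at `3` on a tower-surjective (t′) rank-`0` row with `E(ℚ₃)[3] = 0`, from rung W2's leaf +
ONE level-`k` Kurihara number `δ̃_n^{(k)} ≠ 0` with `k − 1 ≤ v₃(∏ c_ℓ)`** (a datum with `3 ∤ c_D`,
GZK, modularity): the tree's `N11.missingLowerBoundAt_three_of_kimAtThreeRankZeroPUB_of_indexCert` on
the route's rows. `hKim` is the W2 route's target — an `@[conjecture]` node with a refereed cell memo,
NOT a Literature fact; no reduction hypothesis at `3`. Per pair; conditional; nothing credited.
[cite: Kim2025RefinedTNC, Thm. 1.1 and Thm. 1.2 (PDF pp. 5–6)] [cite: Miller2011LMS, Def. 1.1] -/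
theorem tameMissingLowerBoundAt_three_of_kimAtThree_of_indexCert (hKim : N11.KimAtThreeRankZeroPUB)
    (hGZK : rank_eq_analyticRank_of_analyticRank_le_one) (hmod : hasEntireLFunction_rat)
    (W : WeierstrassCurve ℚ) [W.IsElliptic] [W.IsGloballyMinimal] [Fact (3 : ℕ).Prime]
    (hr : W.analyticRank = 0) (_hadd : Addv W 3) (_hT : SubTprime W 3)
    (htower : ∀ n : ℕ, W.HasSurjectiveModNGaloisRep (3 ^ n : ℕ))
    (ht0 : Nat.card {Q : (W.baseChange ℚ_[3]).toAffine.Point // (3 : ℕ) • Q = 0} = 1)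
    {N : ℕ} [NeZero N] (D : ModularParametrizationData W N) (hc : ¬ (3 : ℤ) ∣ D.maninConstant)
    (hper : ∃ u : ℚ, ‖(u : ℚ_[3])‖ = 1 ∧ W.realPeriodRat = u * plusPeriod D.f)
    {k n : ℕ} [NeZero n] (hk : 1 ≤ k) (hn : Kato.IsKolyvaginProduct W 3 k n)
    (hcyc : ∀ (ℓ : ℕ) [Fact ℓ.Prime], ℓ ∣ n →
      Nat.card {P : ((WeierstrassCurve.integralModelInt W).map
          (Int.castRingHom (ZMod ℓ))).toAffine.Point // 3 • P = 0} ≤ 3)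
    (ψ : (ℓ : ℕ) → (ZMod ℓ)ˣ →* Multiplicative (ZMod (3 ^ k)))
    (hψ : ∀ ℓ ∈ n.primeFactors, Function.Surjective (ψ ℓ))
    (hδ : kuriharaNumber D.f (3 ^ k) n ψ ≠ 0) (hkt : k - 1 ≤ padicValNat 3 W.tamagawaProduct) :
    MissingLowerBoundAt W 3 := by
  have hsurj : Surj W 3 := by have h := htower 1; rwa [pow_one] at h
  exact N11.missingLowerBoundAt_three_of_kimAtThreeRankZeroPUB_of_indexCert W hKim hGZK hsurj htower
    ht0 ((W.analyticRank_eq_zero_iff_holds (hmod W)).mp hr) D hc hper hk hn hcyc ψ hψ hδ hkt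

/-- **L₀ at `3` on a tower-surjective (t′) rank-`0` row of Kodaira type `III*` (`v₃(Δ) = 9`), from
rung W2's leaf + ONE level-`k` certificate — NO `t`-binder** (discharged by type `III*`). Per pair;
conditional on the W2 leaf; nothing credited. [cite: Kim2025RefinedTNC, Thm. 1.1/1.2 (PDF pp. 5–6)]
[cite: SilvermanATAEC1994, IV.9.4 Step 9] [cite: Miller2011LMS, Def. 1.1] -/
theorem tameMissingLowerBoundAt_three_IIIstar_of_kimAtThree_of_indexCert
    (hKim : N11.KimAtThreeRankZeroPUB)
    (hGZK : rank_eq_analyticRank_of_analyticRank_le_one) (hmod : hasEntireLFunction_rat)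
    (W : WeierstrassCurve ℚ) [W.IsElliptic] [W.IsGloballyMinimal] [Fact (3 : ℕ).Prime]
    (hr : W.analyticRank = 0) (hadd : Addv W 3) (hT : SubTprime W 3) (h9 : padicValRat 3 W.Δ = 9)
    (htower : ∀ n : ℕ, W.HasSurjectiveModNGaloisRep (3 ^ n : ℕ))
    {N : ℕ} [NeZero N] (D : ModularParametrizationData W N) (hc : ¬ (3 : ℤ) ∣ D.maninConstant)
    (hper : ∃ u : ℚ, ‖(u : ℚ_[3])‖ = 1 ∧ W.realPeriodRat = u * plusPeriod D.f)
    {k n : ℕ} [NeZero n] (hk : 1 ≤ k) (hn : Kato.IsKolyvaginProduct W 3 k n)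
    (hcyc : ∀ (ℓ : ℕ) [Fact ℓ.Prime], ℓ ∣ n →
      Nat.card {P : ((WeierstrassCurve.integralModelInt W).map
          (Int.castRingHom (ZMod ℓ))).toAffine.Point // 3 • P = 0} ≤ 3)
    (ψ : (ℓ : ℕ) → (ZMod ℓ)ˣ →* Multiplicative (ZMod (3 ^ k)))
    (hψ : ∀ ℓ ∈ n.primeFactors, Function.Surjective (ψ ℓ))
    (hδ : kuriharaNumber D.f (3 ^ k) n ψ ≠ 0) (hkt : k - 1 ≤ padicValNat 3 W.tamagawaProduct) :
    MissingLowerBoundAt W 3 :=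
  tameMissingLowerBoundAt_three_of_kimAtThree_of_indexCert hKim hGZK hmod W hr hadd hT htower
    (natCard_threeTorsion_eq_one_of_subTprime_of_padicValRat_Δ_eq_nine W hadd hT h9) D hc hper hk hn
    hcyc ψ hψ hδ hkt

/-- **`BSD(E,3)` on a tower-surjective (t′) rank-`0` row of type `III*` with `3 ∤ ∏ c_ℓ`, from rung
W2's leaf + ONE UNIT Kurihara number** (`X4.KuriharaUnitAt W 3 D.f`): the tree's
`N11.bsdp_three_of_kimAtThreeRankZeroPUB_of_kuriharaUnitAt` with the `t = 0` binder discharged by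
type `III*`. Per pair; conditional on the W2 leaf; nothing credited. [cite: Kim2025RefinedTNC, Thm. 1.1/1.2 (PDF pp. 5–6)]
[cite: SilvermanATAEC1994, IV.9.4 Step 9] [cite: Miller2011LMS, Def. 1.1] -/
theorem tameBsdp_three_IIIstar_of_kimAtThree_of_kuriharaUnitAt (hKim : N11.KimAtThreeRankZeroPUB)
    (hGZK : rank_eq_analyticRank_of_analyticRank_le_one) (hmod : hasEntireLFunction_rat)
    (W : WeierstrassCurve ℚ) [W.IsElliptic] [W.IsGloballyMinimal] [Fact (3 : ℕ).Prime]
    (hr : W.analyticRank = 0) (hadd : Addv W 3) (hT : SubTprime W 3) (h9 : padicValRat 3 W.Δ = 9)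
    (htower : ∀ n : ℕ, W.HasSurjectiveModNGaloisRep (3 ^ n : ℕ))
    {N : ℕ} [NeZero N] (D : ModularParametrizationData W N)
    (hper : ∃ u : ℚ, ‖(u : ℚ_[3])‖ = 1 ∧ W.realPeriodRat = u * plusPeriod D.f)
    (htam : ¬ 3 ∣ W.tamagawaProduct) (hKu : X4.KuriharaUnitAt W 3 D.f) : BSDp W 3 :=
  N11.bsdp_three_of_kimAtThreeRankZeroPUB_of_kuriharaUnitAt W hKim hGZK htower
    (natCard_threeTorsion_eq_one_of_subTprime_of_padicValRat_Δ_eq_nine W hadd hT h9)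
    ((W.analyticRank_eq_zero_iff_holds (hmod W)).mp hr) D hper htam hKu

/-- **The BC5 rung `Sig.stub_lower_three_e4_rung` VERBATIM, from rung W2's leaf, KURIHARA'S
CONJECTURE (level-`k` form, `k − 1 ≤ v₃(∏ c_ℓ)`) on its `t = 0` rows, and the residual type-`III`
rows with `E(ℚ₃)[3] ≠ 0` displayed** (`hres`: `v₃(Δ) ≠ 9`, i.e. Kodaira `III`, AND a `ℚ₃`-rational
`3`-torsion point — the `III*` rows never land there; on those rows only the companions' KMC /
Fouquet–Wan roads exist). A reshaped composition of the plan-only rung; conditional; nothing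
credited. [cite: Kim2025RefinedTNC, Thm. 1.1/1.2 (PDF pp. 5–6)] [cite: Kurihara2014, §1]
[cite: SilvermanATAEC1994, IV.9.4 Step 9] [cite: Miller2011LMS, Def. 1.1] -/
theorem tameLowerHalf_three_e4_rung_of_kimAtThree_of_certs_of_typeIIIRows
    (hKim : N11.KimAtThreeRankZeroPUB)
    (hGZK : rank_eq_analyticRank_of_analyticRank_le_one) (hmod : hasEntireLFunction_rat)
    (hKur : ∀ (W : WeierstrassCurve ℚ) [W.IsElliptic] [W.IsGloballyMinimal],
      W.analyticRank = 0 → Addv W 3 → SubTprime W 3 →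
      (∀ n : ℕ, W.HasSurjectiveModNGaloisRep (3 ^ n : ℕ)) →
      Nat.card {Q : (W.baseChange ℚ_[3]).toAffine.Point // (3 : ℕ) • Q = 0} = 1 →
        ∃ (N : ℕ) (_ : NeZero N) (D : ModularParametrizationData W N),
          ¬ (3 : ℤ) ∣ D.maninConstant ∧
          (∃ u : ℚ, ‖(u : ℚ_[3])‖ = 1 ∧ W.realPeriodRat = u * plusPeriod D.f) ∧
          ∃ (k n : ℕ) (_ : NeZero n), 1 ≤ k ∧ k - 1 ≤ padicValNat 3 W.tamagawaProduct ∧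
            Kato.IsKolyvaginProduct W 3 k n ∧
            (∀ (ℓ : ℕ) [Fact ℓ.Prime], ℓ ∣ n →
              Nat.card {P : ((WeierstrassCurve.integralModelInt W).map
                  (Int.castRingHom (ZMod ℓ))).toAffine.Point // 3 • P = 0} ≤ 3) ∧
            ∃ ψ : (ℓ : ℕ) → (ZMod ℓ)ˣ →* Multiplicative (ZMod (3 ^ k)),
              (∀ ℓ ∈ n.primeFactors, Function.Surjective (ψ ℓ)) ∧
                kuriharaNumber D.f (3 ^ k) n ψ ≠ 0)
    (hres : ∀ (W : WeierstrassCurve ℚ) [W.IsElliptic] [W.IsGloballyMinimal] [Fact (3 : ℕ).Prime],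
      W.analyticRank = 0 → Addv W 3 → SubTprime W 3 →
      (∀ n : ℕ, W.HasSurjectiveModNGaloisRep (3 ^ n : ℕ)) → padicValRat 3 W.Δ ≠ 9 →
      Nat.card {Q : (W.baseChange ℚ_[3]).toAffine.Point // (3 : ℕ) • Q = 0} ≠ 1 →
        MissingLowerBoundAt W 3) :
    ∀ (W : WeierstrassCurve ℚ) [W.IsElliptic] [W.IsGloballyMinimal] [Fact (3 : ℕ).Prime],
      W.analyticRank = 0 → Addv W 3 → SubTprime W 3 →
      (∀ n : ℕ, W.HasSurjectiveModNGaloisRep (3 ^ n : ℕ)) → MissingLowerBoundAt W 3 := by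
  intro W _ _ _ hr hadd hT htower
  by_cases ht0 : Nat.card {Q : (W.baseChange ℚ_[3]).toAffine.Point // (3 : ℕ) • Q = 0} = 1
  · obtain ⟨N, hN, D, hc, hper, k, n, hn0, hk, hkt, hn, hcyc, ψ, hψ, hδ⟩ :=
      hKur W hr hadd hT htower ht0
    haveI := hN
    haveI := hn0
    exact tameMissingLowerBoundAt_three_of_kimAtThree_of_indexCert hKim hGZK hmod W hr hadd hT htower
      ht0 D hc hper hk hn hcyc ψ hψ hδ hkt
  · have h9 : padicValRat 3 W.Δ ≠ 9 := fun h9 =>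
      ht0 (natCard_threeTorsion_eq_one_of_subTprime_of_padicValRat_Δ_eq_nine W hadd hT h9)
    exact hres W hr hadd hT htower h9 ht0

end Three

/-! ## §3 Any odd `p`, any image: the native `p`-descent certificate + Cassels–Tate -/

section Descent

/-- **L₀ at a (t′) rank-`0` pair with `ord_p #Ш_an ≤ 2` from ONE non-zero `p`-Selmer class**
(`Sel^{(p)}(E/ℚ) ≠ 0` with `rank E(ℚ) = 0` and `p ∤ #E(ℚ)_tors` gives `Ш(E/ℚ)[p] ≠ 0`, and
Cassels–Tate squareness `hCT` upgrades it to `p² ∣ #Ш`; GZK `hGZK`): the cell's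
`Supersingular.missingLowerBoundAt_of_casselsTate_of_selmerGroup_ne_bot` on the route's rows — the road
with NO image hypothesis, left for the reducible rows X3 ∩ (t′) with `p ∤ #E(ℚ)_tors`. Per pair.
[cite: Cassels1962ArithmeticIV, Thm. 1.1] [cite: Darmon2004, Thm. 3.22] [cite: Miller2011LMS, Def. 1.1] -/
theorem tameMissingLowerBoundAt_rankZero_of_selmer_ne_bot
    (hCT : exists_casselsTate_pairing (K := ℚ))
    (hGZK : rank_eq_analyticRank_of_analyticRank_le_one)
    (W : WeierstrassCurve ℚ) [W.IsElliptic] [W.IsGloballyMinimal] (p : ℕ) [Fact p.Prime]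
    (hr : W.analyticRank = 0) (_hadd : Addv W p) (_hT : SubTprime W p)
    (htors : ¬ p ∣ W.torsionOrder) {q : ℚ} (hq : shaAn W = (q : ℂ)) (hv : padicValRat p q ≤ 2)
    (hSel : W.selmerGroup (p : ℤ) ≠ ⊥) : MissingLowerBoundAt W p :=
  Supersingular.missingLowerBoundAt_of_casselsTate_of_selmerGroup_ne_bot W p hCT hGZK hr htors hq hv
    hSel

end Descent

/-! ## §4 The crux BY NAME: Kurihara certificates on the large-image rows + the residual rows displayed -/

section Composition

/-- **`TameLowerHalfRankZero` from Kim's published theorem (`p ≥ 5`), rung W2's leaf (`p = 3`),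
KURIHARA'S CONJECTURE on the certificate rows, and the RESIDUAL rows displayed as one hypothesis.**
Certificate rows: `p ≥ 5 ∧ ρ̄_{E,p}` onto (hypothesis `hKur`, level `k ≤ ord_p ∏ c_ℓ + 1`) and
`p = 3 ∧` tower onto `∧ #E(ℚ₃)[3] = 1` (hypothesis `hKur3`, level `k − 1 ≤ v₃ ∏ c_ℓ`). Residual rows
(`hres`): `p ≥ 5` with `ρ̄` not onto — the reducible rows X3 ∩ (t′) (50a1@5, 121a/c@11, …), the
normaliser-of-Cartan / exceptional images, the CM rows (in print: companion file `…CMRows`) — and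
`p = 3` off the `3`-adic tower or of type `III` with `E(ℚ₃)[3] ≠ 0`; there the tree has only the
companions' KMC / Fouquet–Wan roads and §3's descent certificates. A reshaped composition for the
tenure planner: on the certificate rows L₀ is "PUBLISHED theorem + a finite certificate per pair"
(class-wide: Kato's IMC with `μ = 0`). Conditional; the item is NOT closed.
[cite: Kim2022StructureSelmer, Thm. 1.9 (6), Thm. 1.11, Conj. 1.3 (PDF pp. 7–8)]
[cite: Kim2025RefinedTNC, Thm. 1.1/1.2 (PDF pp. 5–6)] [cite: Kurihara2014, §1] [cite: Miller2011LMS, Def. 1.1] -/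
theorem tameLowerHalfRankZero_of_kuriharaCerts_of_residualRows
    (hKim : Kim2026.rankZero_le_padicValNat_sha_of_kuriharaNumber_ne_zero)
    (hKim3 : N11.KimAtThreeRankZeroPUB)
    (hGZK : rank_eq_analyticRank_of_analyticRank_le_one) (hmod : hasEntireLFunction_rat)
    (hKur : ∀ (W : WeierstrassCurve ℚ) [W.IsElliptic] [W.IsGloballyMinimal] (p : ℕ) [Fact p.Prime],
      W.analyticRank = 0 → 5 ≤ p → Addv W p → SubTprime W p → Surj W p →
        ∃ (N : ℕ) (_ : NeZero N) (D : ModularParametrizationData W N),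
          ¬ (p : ℤ) ∣ D.maninConstant ∧
          (∃ u : ℚ, ‖(u : ℚ_[p])‖ = 1 ∧ W.realPeriodRat = u * plusPeriod D.f) ∧
          ∃ (k n : ℕ) (_ : NeZero n), 1 ≤ k ∧ k ≤ padicValNat p W.tamagawaProduct + 1 ∧
            Kato.IsKolyvaginProduct W p k n ∧
            (∀ (ℓ : ℕ) [Fact ℓ.Prime], ℓ ∣ n →
              Nat.card {P : ((WeierstrassCurve.integralModelInt W).map
                  (Int.castRingHom (ZMod ℓ))).toAffine.Point // p • P = 0} ≤ p) ∧
            ∃ ψ : (ℓ : ℕ) → (ZMod ℓ)ˣ →* Multiplicative (ZMod (p ^ k)),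
              (∀ ℓ ∈ n.primeFactors, Function.Surjective (ψ ℓ)) ∧
                kuriharaNumber D.f (p ^ k) n ψ ≠ 0)
    (hKur3 : ∀ (W : WeierstrassCurve ℚ) [W.IsElliptic] [W.IsGloballyMinimal],
      W.analyticRank = 0 → Addv W 3 → SubTprime W 3 →
      (∀ n : ℕ, W.HasSurjectiveModNGaloisRep (3 ^ n : ℕ)) →
      Nat.card {Q : (W.baseChange ℚ_[3]).toAffine.Point // (3 : ℕ) • Q = 0} = 1 →
        ∃ (N : ℕ) (_ : NeZero N) (D : ModularParametrizationData W N),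
          ¬ (3 : ℤ) ∣ D.maninConstant ∧
          (∃ u : ℚ, ‖(u : ℚ_[3])‖ = 1 ∧ W.realPeriodRat = u * plusPeriod D.f) ∧
          ∃ (k n : ℕ) (_ : NeZero n), 1 ≤ k ∧ k - 1 ≤ padicValNat 3 W.tamagawaProduct ∧
            Kato.IsKolyvaginProduct W 3 k n ∧
            (∀ (ℓ : ℕ) [Fact ℓ.Prime], ℓ ∣ n →
              Nat.card {P : ((WeierstrassCurve.integralModelInt W).map
                  (Int.castRingHom (ZMod ℓ))).toAffine.Point // 3 • P = 0} ≤ 3) ∧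
            ∃ ψ : (ℓ : ℕ) → (ZMod ℓ)ˣ →* Multiplicative (ZMod (3 ^ k)),
              (∀ ℓ ∈ n.primeFactors, Function.Surjective (ψ ℓ)) ∧
                kuriharaNumber D.f (3 ^ k) n ψ ≠ 0)
    (hres : ∀ (W : WeierstrassCurve ℚ) [W.IsElliptic] [W.IsGloballyMinimal] (p : ℕ) [Fact p.Prime],
      W.analyticRank = 0 → p ≠ 2 → Addv W p → SubTprime W p →
      ¬ ((5 ≤ p ∧ Surj W p) ∨
          (p = 3 ∧ (∀ n : ℕ, W.HasSurjectiveModNGaloisRep (p ^ n : ℕ)) ∧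
            Nat.card {Q : (W.baseChange ℚ_[p]).toAffine.Point // (p : ℕ) • Q = 0} = 1)) →
        MissingLowerBoundAt W p) :
    TameLowerHalfRankZero := by
  intro W _ _ p _ hr hp2 hadd hT
  by_cases hA : 5 ≤ p ∧ Surj W p
  · -- `p ≥ 5`, `ρ̄` onto: Kim's published theorem + the certificate supplied by `hKur`
    exact tameLowerHalf_largeImage_of_kimLower_of_kuriharaCerts hKim hGZK hmod hKur W p hr hA.1 hadd
      hT hA.2
  · by_cases hB : p = 3 ∧ ∀ n : ℕ, W.HasSurjectiveModNGaloisRep (p ^ n : ℕ)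
    · -- `p = 3`, tower onto: the BC5 rung through rung W2's leaf; its residual type-`III` rows with a
      -- local `3`-torsion point are handed to `hres`
      obtain ⟨rfl, htower⟩ := hB
      refine tameLowerHalf_three_e4_rung_of_kimAtThree_of_certs_of_typeIIIRows hKim3 hGZK hmod hKur3
        ?_ W hr hadd hT htower
      intro W' _ _ _ hr' hadd' hT' htower' _ ht0'
      exact hres W' 3 hr' (by decide) hadd' hT'
        (by rintro (h | h) <;> [exact absurd h.1 (by decide); exact ht0' h.2.2])
    · exact hres W p hr hp2 hadd hT
        (by rintro (h | h) <;> [exact hA h; exact hB ⟨h.1, h.2.1⟩])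

end Composition

end Summit.BirchSwinnertonDyer.BirchSwinnertonDyer.Theorems

end
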